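import Literature.MathematicalPhysics.QuantumLattice.ReehSchliederSeparating
import Literature.Analysis.FunctionSpaces.WightmanReehSchliederProofs
import HarnessLib

/-!
# Streater–Wightman Thm 4-3 holds: discharge of `IsWightmanQFT.reehSchlieder_separating`

Topic `Literature/MathematicalPhysics/QuantumLattice` (trunk T-AQFT), sibling of
`ReehSchliederSeparating.lean` (kept low in the import graph for its importers
`Literature.Barriers.QuantumFields.JostSchroer*`; the Reeh–Schlieder machinery is imported here
instead).

Streater–Wightman §4-2, Thm 4-3 (held 2000 printing, pdf p. 124): "If `𝒪` is an open set for which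
`𝒪'` is not empty, and `T ∈ 𝒫(𝒪)`, then `TΨ₀ = 0` implies `T = 0`." The tree states it as the
named fact `IsWightmanQFT.reehSchlieder_separating` and proves it from the Reeh–Schlieder theorem
(Thm 4-2, named fact `Literature.Analysis.FunctionSpaces.reeh_schlieder`) in
`IsWightmanQFT.reehSchlieder_separating_of_reeh_schlieder`, following the printed proof (4-12).
Thm 4-2 is now proved in the tree (`Literature.Analysis.FunctionSpaces.reeh_schlieder_holds`,
`WightmanReehSchliederProofs`), so Thm 4-3 holds unconditionally:

* `IsWightmanQFT.reehSchlieder_separating_holds` — **the named fact holds**;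
* `IsWightmanQFT.eq_zero_of_mem_localPolynomials` — Thm 4-3 in applicable form: under the Wightman
  axioms, `T ∈ 𝒫(𝒪)`, `𝒪` open with `𝒪' ≠ ∅`, and `TΨ₀ = 0` imply `T = 0`;
* `IsWightmanQFT.eq_zero_of_mem_localPolynomials_of_isBounded'` — the same for bounded open `𝒪`
  (Remark 2 after Thm 4-3: `𝒪'` is then nonempty; space dimension `d ≥ 1`).

## References

* R. F. Streater, A. S. Wightman, *PCT, Spin and Statistics, and All That* (1964; Princeton 2000,
  pdf p. 124), §4-2, Thm 4-3 with its proof (4-12) and Remark 2; Thm 4-2. [StreaterWightman2001]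
* H. Reeh, S. Schlieder, Nuovo Cimento 22 (1961) 1051–1068. [ReehSchlieder1961]

## Mathlib / tree

From the tree: `IsWightmanQFT.reehSchlieder_separating_of_reeh_schlieder`,
`IsWightmanQFT.eq_zero_of_mem_localPolynomials_of_isBounded` (`ReehSchliederSeparating`),
`Literature.Analysis.FunctionSpaces.reeh_schlieder_holds` (`WightmanReehSchliederProofs`).
No new definitions.
-/

noncomputable section

namespace Literature.MathematicalPhysics.QuantumLattice.IsWightmanQFT

variable {d : ℕ} {κ : Type*} {W : WightmanData d κ}

/-- **Streater–Wightman Thm 4-3 holds**: the named fact `reehSchlieder_separating` — "If `𝒪` is an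
open set for which `𝒪'` is not empty, and `T ∈ 𝒫(𝒪)`, then `TΨ₀ = 0` implies `T = 0`" — from the
Reeh–Schlieder theorem (Thm 4-2, `Literature.Analysis.FunctionSpaces.reeh_schlieder_holds`) by the
printed argument (4-12) (`reehSchlieder_separating_of_reeh_schlieder`).
[cite: StreaterWightman2001, §4-2 Thm 4-3] -/
theorem reehSchlieder_separating_holds : reehSchlieder_separating W :=
  reehSchlieder_separating_of_reeh_schlieder Literature.Analysis.FunctionSpaces.reeh_schlieder_holds

/-- **Thm 4-3, applicable form**: in a Wightman QFT, if `𝒪` is open with nonempty causal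
complement `𝒪'`, `T ∈ 𝒫(𝒪)` and `TΨ₀ = 0`, then `T = 0` ("no annihilation operator can be
constructed out of the field operators in a finite region").
[cite: StreaterWightman2001, §4-2 Thm 4-3] -/
theorem eq_zero_of_mem_localPolynomials (hW : IsWightmanQFT W) {O : Set (SpaceTime d)}
    (hO : IsOpen O) (hO' : (causalComplement d O).Nonempty) {T : W.dom →ₗ[ℂ] W.dom}
    (hT : T ∈ W.localPolynomials O) (hT0 : T W.vacuumDom = 0) : T = 0 :=
  reehSchlieder_separating_holds hW hO hO' T hT hT0

/-- **Thm 4-3 for bounded open regions** (Remark 2 after Thm 4-3: "Any bounded open set `𝒪` has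
the property that `𝒪'` is non-empty, and so the theorem applies"; space dimension `d ≥ 1`), now
unconditional. [cite: StreaterWightman2001, §4-2 Thm 4-3 Remark 2] -/
theorem eq_zero_of_mem_localPolynomials_of_isBounded' [NeZero d] (hW : IsWightmanQFT W)
    {O : Set (SpaceTime d)} (hO : IsOpen O) (hOb : Bornology.IsBounded O)
    {T : W.dom →ₗ[ℂ] W.dom} (hT : T ∈ W.localPolynomials O) (hT0 : T W.vacuumDom = 0) : T = 0 :=
  eq_zero_of_mem_localPolynomials_of_isBounded Literature.Analysis.FunctionSpaces.reeh_schlieder_holds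
    hW hO hOb hT hT0

end Literature.MathematicalPhysics.QuantumLattice.IsWightmanQFT
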